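import Summits.ResolutionOfSingularities.ResolutionOfSingularities.Theorems.FrobeniusClosingPatchingRelPerfectChartStrictExceptional
import Literature.AlgebraicGeometry.Resolution.BlowupChartQuotients
import HarnessLib

/-!
# Crux `PatchingRelPerfect` (stmt-ResolutionOfSingularities-16161), chain w52 — rung toolkit:
# a TRANSVERSAL HYPERSURFACE through the charts of a point/linear blow-up (first bricks of the
# «three-letter step» for the contact-migration members)

[OURS · L1 W5.2 · rung tool] Setting as `…ChartStrictExceptional.lean`: `A` a ring, `c = (t, v₁, …, v_m)`
quasi-regular, `C` the `v_k`-chart of `Bl_{(c)} Spec A` (exceptional parameter `w = v_k/1`, `u' = t/v_k`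
the strict transform of `V(t)`), `Φ : C ≅ A[(c)/v_k]` (Stacks 0804).  NEW: a hypersurface `V(o)`,
`o ∈ A`, NOT containing the centre (`o ∉ (c)`; typically TRANSVERSAL: `A/((c) + (o))` a domain).  Its
strict transform on the chart is the total transform `V(φ o)` and we PROVE:

* `transv_not_dvd` — `v_k ∤ o` in `A[(c)/v_k]` (`φ o ∉ (w)`: modulo `w` it is the non-zero constant `ō`);
* `transv_isDomain_quot` — **`C ⧸ (φ o)` is a domain** when `A/(o)` is and `v_k ∉ (o)`
  (`≅ (A/(o))[(c̄)/v̄_k]`, Görtz–Wedhorn 13.96 (2) with `n = 0`: `blowupAlgebra.quotientKerMapQuotientEquiv`);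
* `transv_isDomain_quot_sup` — `C ⧸ ((w) + (φ o))` is a domain when `A/((c) + (o))` is (the stage
  isomorphism `chartStageEquiv` with `K = (o)`): the exceptional divisor meets `V(φ o)` in an integral
  scheme;
* `transv_chartGen_notMem` — `u' ∉ (w) + (φ o)` (it is a variable of that stage polynomial ring), hence
  `u' ∉ (φ o)`;
* `transv_isWeaklyRegular_pair`, `transv_isQuasiRegular_pair` — **the pair `(φ o, u')` is weakly regular,
  hence quasi-regular**, when `A` is a domain (`φ o ≠ 0`, `C/(φ o)` a domain, `u' ∉ (φ o)`): the input of the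
  regular-centre tower for a centre `V(φ o, u')` = (strict transform of `V(o)`) ∩ (strict transform of `V(t)`).

Arbitrary commutative rings; nothing here is a statement of the manuscript under review.

## References

* The Stacks Project, Tags 0804, 0BIQ. [StacksProject]
* U. Görtz, T. Wedhorn, *Algebraic Geometry I*, 2nd ed. 2020, Prop. 13.96 (2), p. 416. [GortzWedhorn2020]
* H. Matsumura, *Commutative Ring Theory*, CUP 1986, Thm. 16.2 (i). [Matsumura1987]
-/

-- `Summit.<Summit>.<Sub>.Theorems` with `Sub = Summit` (single-conjunct summit, D-0017)
set_option linter.dupNamespace false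

noncomputable section

open CategoryTheory CategoryTheory.Limits AlgebraicGeometry Literature.AlgebraicGeometry.Resolution
open IsLocalRing

namespace Summit.ResolutionOfSingularities.ResolutionOfSingularities.Theorems

namespace ConeRung

universe u

section Transversal

variable {A : Type u} [CommRing A] {m : ℕ} (t : A) (v : Fin m → A) (k : Fin m) (o : A)

local notation3 "cc" => (Fin.cons t v : Fin (m + 1) → A)
local notation3 "II" => Ideal.span (Set.range (Fin.cons t v : Fin (m + 1) → A))
local notation3 "C" => chartRing cc (Fin.succ k)
local notation3 "ψ" => chartBase cc (Fin.succ k)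
local notation3 "w" => chartBase cc (Fin.succ k) (cc (Fin.succ k))
local notation3 "u'" => chartGen cc (Fin.succ k) 0
local notation3 "RR" => blowupAlgebra (Ideal.span (Set.range (Fin.cons t v : Fin (m + 1) → A)))
  ((Fin.cons t v : Fin (m + 1) → A) (Fin.succ k))
local notation3 "Φ" => reesChartEquiv (I := Ideal.span (Set.range (Fin.cons t v : Fin (m + 1) → A)))
  ((Fin.cons t v : Fin (m + 1) → A) (Fin.succ k))
  (Ideal.mem_span_range_self (f := (Fin.cons t v : Fin (m + 1) → A)) (x := Fin.succ k))

/-- `φ o ∉ (w)` when `o ∉ (c)`: modulo `w` the image of `o` is the constant `ō ≠ 0` of the polynomial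
ring `C/(w) ≅ (A/(c))[T]`. [cite: StacksProject, Tag 0BIQ] -/
theorem transv_chartBase_notMem_span (hc : IsQuasiRegular cc) (ho : o ∉ II) :
    ψ o ∉ Ideal.span {w} := by
  intro h
  have hC : chartQuotEquiv cc (Fin.succ k) hc (MvPolynomial.C (Ideal.Quotient.mk II o)) =
      Ideal.Quotient.mk (Ideal.span {w}) (ψ o) := by
    rw [chartQuotEquiv_apply, chartQuotMap_C]
  rw [Ideal.Quotient.eq_zero_iff_mem.mpr h,
    map_eq_zero_iff _ (chartQuotEquiv cc _ hc).injective, MvPolynomial.C_eq_zero,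
    Ideal.Quotient.eq_zero_iff_mem] at hC
  exact ho hC

/-- `v_k ∤ o` in `A[(c)/v_k]` when `o ∉ (c)`. [folklore] -/
theorem transv_not_dvd (hc : IsQuasiRegular cc) (ho : o ∉ II) :
    ¬ algebraMap A RR (cc (Fin.succ k)) ∣ Φ (ψ o) := by
  rintro ⟨y, hy⟩
  apply transv_chartBase_notMem_span t v k o hc ho
  rw [Ideal.mem_span_singleton]
  refine ⟨(Φ).symm y, (Φ).injective ?_⟩
  rw [map_mul, RingEquiv.apply_symm_apply, hy, strictExc_equiv_chartBase]

/-- The transversal factorisation (exponent zero): `o = v_k⁰ · Φ(φ o)`. [folklore] -/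
theorem transv_factor :
    algebraMap A RR o = algebraMap A RR (cc (Fin.succ k)) ^ 0 * Φ (ψ o) := by
  rw [pow_zero, one_mul, strictExc_equiv_chartBase]

/-- **`C ⧸ (φ o)` is a domain** when `A/(o)` is a domain, `A/(c)` is a domain, `o ∉ (c)` and
`v_k ∉ (o)`: `C/(φ o) ≅ (A/(o))[(c̄)/v̄_k] ⊆ (A/(o))[1/v̄_k]`.
[cite: GortzWedhorn2020, Prop. 13.96 (2) and p. 416] [cite: StacksProject, Tag 0804] -/
theorem transv_isDomain_quot (hc : IsQuasiRegular cc) [IsDomain (A ⧸ II)]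
    [IsDomain (A ⧸ Ideal.span {o})] (ho : o ∉ II) (hvo : v k ∉ Ideal.span {o}) :
    IsDomain (C ⧸ Ideal.span {ψ o}) := by
  have hne : Ideal.Quotient.mk (Ideal.span {o}) (cc (Fin.succ k)) ≠ 0 := by
    rw [Fin.cons_succ, Ne, Ideal.Quotient.eq_zero_iff_mem]
    exact hvo
  haveI : IsDomain (Localization.Away (Ideal.Quotient.mk (Ideal.span {o}) (cc (Fin.succ k)))) :=
    IsLocalization.isDomain_localization (powers_le_nonZeroDivisors_of_noZeroDivisors hne)
  haveI : IsDomain (blowupAlgebra ((II).map (Ideal.Quotient.mk (Ideal.span {o})))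
      (Ideal.Quotient.mk (Ideal.span {o}) (cc (Fin.succ k)))) := inferInstance
  let e := blowupAlgebra.quotientKerMapQuotientEquiv (II) (cc (Fin.succ k))
    (transv_factor t v k o) (strictExc_prime_algebraMap t v k hc) (transv_not_dvd t v k o hc ho)
  have e1 : (C ⧸ Ideal.span {ψ o}) ≃+* (RR ⧸ Ideal.span {Φ (ψ o)}) :=
    Ideal.quotientEquiv _ _ (Φ) (by rw [Ideal.map_span, Set.image_singleton]; rfl)
  exact MulEquiv.isDomain _ (e1.trans e).toMulEquiv

/-- The stage ideal `(w) + (o)·C + 0` is `(w) + (φ o)`. [folklore] -/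
theorem transv_chartStageIdeal_eq :
    chartStageIdeal cc (Fin.succ k) (Ideal.span {o}) ∅ = Ideal.span {w} ⊔ Ideal.span {ψ o} := by
  rw [chartStageIdeal, Ideal.map_span, Set.image_singleton, Set.image_empty, Ideal.span_empty,
    sup_bot_eq]

/-- **`C ⧸ ((w) + (φ o))` is a domain** when `A/((c) + (o))` is: the exceptional divisor meets the
transversal hypersurface in `Spec (A/((c)+(o)))[T]` (stage isomorphism). [cite: StacksProject, Tag 0BIQ] -/
theorem transv_isDomain_quot_sup (hc : IsQuasiRegular cc) [IsDomain (A ⧸ (II ⊔ Ideal.span {o}))] :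
    IsDomain (C ⧸ (Ideal.span {w} ⊔ Ideal.span {ψ o})) := by
  have e := chartStageEquiv cc (Fin.succ k) (Ideal.span {o}) ∅ hc (Set.notMem_empty _)
  rw [transv_chartStageIdeal_eq] at e
  exact MulEquiv.isDomain _ e.symm.toMulEquiv

/-- **`u' ∉ (w) + (φ o)`** when `A/((c) + (o))` is non-trivial: `u'` is a variable of the stage
polynomial ring. [cite: StacksProject, Tag 0BIQ] -/
theorem transv_chartGen_notMem_sup (hc : IsQuasiRegular cc) [Nontrivial (A ⧸ (II ⊔ Ideal.span {o}))] :
    u' ∉ Ideal.span {w} ⊔ Ideal.span {ψ o} := by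
  intro h
  have hX : chartStageEquiv cc (Fin.succ k) (Ideal.span {o}) ∅ hc (Set.notMem_empty _)
      (MvPolynomial.X ⟨0, (Fin.succ_ne_zero k).symm, Set.notMem_empty _⟩) =
      Ideal.Quotient.mk _ u' := by
    rw [chartStageEquiv_X]
  rw [← transv_chartStageIdeal_eq] at h
  rw [Ideal.Quotient.eq_zero_iff_mem.mpr h, map_eq_zero_iff _ (chartStageEquiv cc _ _ _ hc _).injective]
    at hX
  exact MvPolynomial.X_ne_zero _ hX

/-- Hence `u' ∉ (φ o)`. [folklore] -/
theorem transv_chartGen_notMem (hc : IsQuasiRegular cc) [Nontrivial (A ⧸ (II ⊔ Ideal.span {o}))] :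
    u' ∉ Ideal.span {ψ o} :=
  fun h => transv_chartGen_notMem_sup t v k o hc (Ideal.mem_sup_right h)

/-- `φ o ≠ 0` in `A[(c)/v_k]`-coordinates: `Φ(φ o) = o ≠ 0` when `A` is a domain and `o ≠ 0`.
[folklore] -/
theorem transv_equiv_chartBase_ne_zero [IsDomain A] (ho0 : o ≠ 0) (hvk0 : cc (Fin.succ k) ≠ 0) :
    Φ (ψ o) ≠ 0 := by
  rw [strictExc_equiv_chartBase]
  intro h
  have h' := congrArg Subtype.val h
  rw [Subalgebra.coe_algebraMap, ZeroMemClass.coe_zero] at h'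
  exact ho0 (IsLocalization.injective (Localization.Away (cc (Fin.succ k)))
    (powers_le_nonZeroDivisors_of_noZeroDivisors hvk0) (by rw [h', map_zero]))

/-- **The pair `(φ o, u')` is weakly regular on the chart** — the centre
`V(φ o, u') = (strict transform of V(o)) ∩ (strict transform of V(t))` of a three-letter step.
[cite: Matsumura1987, Thm. 16.2 (i)] -/
theorem transv_isWeaklyRegular_pair [IsDomain A] (hc : IsQuasiRegular cc) [IsDomain (A ⧸ II)]
    [IsDomain (A ⧸ Ideal.span {o})] [IsDomain (A ⧸ (II ⊔ Ideal.span {o}))]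
    (ho : o ∉ II) (hvo : v k ∉ Ideal.span {o}) :
    RingTheory.Sequence.IsWeaklyRegular C (List.ofFn (Fin.cons (ψ o) fun _ : Fin 1 => u')) := by
  haveI := transv_isDomain_quot t v k o hc ho hvo
  have ho0 : o ≠ 0 := fun h => ho (h ▸ Ideal.zero_mem _)
  have hvk0 : cc (Fin.succ k) ≠ 0 := by
    rw [Fin.cons_succ]
    exact fun h => hvo (h ▸ Ideal.zero_mem _)
  haveI : IsDomain (Localization.Away (cc (Fin.succ k))) :=
    IsLocalization.isDomain_localization (powers_le_nonZeroDivisors_of_noZeroDivisors hvk0)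
  haveI : IsDomain RR := inferInstance
  exact isWeaklyRegular_pair_of_equiv (Φ) (transv_equiv_chartBase_ne_zero t v k o ho0 hvk0)
    (transv_chartGen_notMem t v k o hc)

/-- **Hence `(φ o, u')` is quasi-regular on the chart.** [cite: Matsumura1987, Thm. 16.2 (i)] -/
theorem transv_isQuasiRegular_pair [IsDomain A] (hc : IsQuasiRegular cc) [IsDomain (A ⧸ II)]
    [IsDomain (A ⧸ Ideal.span {o})] [IsDomain (A ⧸ (II ⊔ Ideal.span {o}))]
    (ho : o ∉ II) (hvo : v k ∉ Ideal.span {o}) :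
    IsQuasiRegular (Fin.cons (ψ o) fun _ : Fin 1 => u' : Fin 2 → C) :=
  isQuasiRegular_of_isWeaklyRegular _ (transv_isWeaklyRegular_pair t v k o hc ho hvo)

end Transversal

end ConeRung

end Summit.ResolutionOfSingularities.ResolutionOfSingularities.Theorems

end
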